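import Mathlib.Analysis.SpecificLimits.Normed
import Mathlib.Analysis.Normed.Operator.NormedSpace
import Mathlib.Analysis.Normed.Operator.Completeness
import Mathlib.Analysis.Complex.Basic
import Mathlib.Algebra.Order.Chebyshev
import HarnessLib

/-!
# Route `UnitScaleTilt`, crux K1 «MinimiserStabilityRegPr» (stmt-QuantumFields-19200), route-R E′, architecture (A′) «HCOW-VIA-Σ» (★★OWNER RULING g28-№13), package P-A4
# «CRUDE SLICE ON PRINT'S SLICE», CURVED — FILE F1-core «ABSTRACT BLOCK COMPETITOR»: for a site field `f` on a finite set of sites partitioned into blocks, the BUBBLE COMPETITOR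
# `f_C(x) := φ(x)·σ_x⁻¹ ν_{B(x)}`, `ν_y := M_y⁻¹ (Avg f)(y)`, has (i) the SAME transported block averages as `f` (exact coset match: `Avg f_C = Avg f`) and (ii) energy
# `Σ_bonds ‖τ_b f_C(b₊) − f_C(b₋)‖² ≤ 2·(A + h²·B)·μ²·w·Σ_x ‖f(x)‖²` from FIVE displayed scalar rows (bump rows `A`, `B`, boundary layer; holonomy row `h`; Neumann row `μ`) —
# lattice-free, so that the member instantiation (F1-inst) only has to plug print's comb letters (px11 g5's rows (κ)(θ″)) and the bump profile (B-β) into it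

Cell `ym3-torus`, width seat `ym3-torus-px19` (gen 5); pens of record px12 g5 2026-08-29 02:39:52Z «V1 + V3≡F1 + B-N + B-β = px19 · F2 = px11 · F3 = px12»; LOCATEs `LOCATE-PA4-VARIATIONAL-px19g5.md`
(19200 evidence e2f41ebfcc92d0cd) §0 (B) and px11 g5 `LOCATE-PA4CURVED-ELEM-px11g5.md` §2 (M2)(M3) (same mechanism, found independently; numerics kit j322959: optimal `C_P·ℓ² ≈ 32`,
competitor 22–39).  WHERE IT SITS: ✓p690789 `Prop7BernsteinKerRSVariational` (V1) reduces Bernstein on `ker R(U₀)` (the `hBern` of ✓p687224, i.e. the crude slice `DIV ≤ C_P·M` on print's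
slice) to ONE competitor per `f` in `f + N(Q′)`; this file BUILDS the competitor and bounds its energy, abstractly; F1-inst reads it at the torus member with `X := Site (F.P K) 0`, blocks =
print's top blocks, `τ∕σ∕ρ :=` conjugations by the background bond ∕ the comb rotation `axialFn` ∕ the `Q′_k` transports `trIter`, rows := F2 (px11) + B-β, and `Avg := Q′_k(U₀)`;
F3 (px12) reads F1-inst + V1 at `f := D*_{U₀}X̃` under `IsLandauPrint`.  THEOREMS ONLY (0 `def`, 0 `sorry`); `--supports stmt-QuantumFields-19200 --as helper`, count-neutral.  YM₃ on T³ is a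
ladder rung (R3), not the Clay problem; nothing here claims `bern_P`, `hcoW`, E′, a stub, the crux, d = 4 or the mass gap.

LETTERS (all abstract).  Finite types `X` (sites), `Y` (blocks), `E` (bonds); `blk : X → Y`; `src tgt : E → X`; a normed `ℂ`-space `W` (at the member: `W₂`, the Frobenius `M₂(ℂ)`);
bond transports `τ : E → W →L[ℂ] W` (`‖τ_e v‖ ≤ ‖v‖`); comb rotations `σ σ' : X → W →L[ℂ] W` with `σ'_x (σ_x u) = u`, `‖σ'_x v‖ ≤ ‖v‖` (at the member: `R(g_x)`, `R(g_x⁻¹)`);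
averaging transports `ρ : X → W →L[ℂ] W` (`‖ρ_x v‖ ≤ ‖v‖`); weight `w ≥ 0` with `w·#B(y) ≤ 1`; bump `φ : X → ℝ`; `Avg g y := (w:ℂ) • Σ_{blk x = y} ρ_x (g x)`; per-block inverses
`Minv : Y → W →L[ℂ] W`; the competitor `fC` and its data `ν` are FREE symbols with defining hypotheses `hν`, `hfC` (so F1-inst may letter them as it likes).

WHAT IS PROVED (ns `…Theorems.Prop7BlockCompetitorEnergy`).
* §1 (B-N) ★★ `exists_inverse_of_norm_sub_smul_one_le` — NEUMANN ON `W →L[ℂ] W` (`W` complete): `0 < m`, `‖M − m•1‖ ≤ m∕2` ⊢ `∃ Minv, M ∘L Minv = 1 ∧ Minv ∘L M = 1 ∧ ‖Minv‖ ≤ 2∕m`.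
* §2 ★★ `avg_competitor_eq` — EXACT COSET MATCH: row (R-M) «`∀ y v, (w:ℂ) • Σ_{blk x = y} (φ x : ℂ) • ρ_x (σ'_x (Minv_y v)) = v`» ⊢ `Avg fC y = Avg f y` for every block `y`.
* §3 ★ `norm_bond_term_le` (one bond: `‖τ_e fC(e₊) − fC(e₋)‖ ≤ |φ(e₊) − φ(e₋)|·‖ν‖ + φ(e₋)·h·‖ν‖` inside a block; `= 0` across blocks),
  ★★★ `competitor_energy_le` — rows (R-∂) «across blocks `φ(e₋) = φ(e₊) = 0`», (R-A) «`Σ_{blk e₋ = y} (φ e₊ − φ e₋)² ≤ A`», (R-B) «`Σ_{blk e₋ = y} (φ e₋)² ≤ B`», (R-hol)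
  «inside blocks `‖σ_{e₋} τ_e σ'_{e₊} v − v‖ ≤ h‖v‖`», (R-μ) «`‖Minv_y v‖ ≤ μ‖v‖`», (R-w) «`w·#B(y) ≤ 1`» ⊢ `Σ_e ‖τ_e fC(e₊) − fC(e₋)‖² ≤ 2·(A + h²·B)·μ²·w·Σ_x ‖f x‖²`.
* §4 (v1.1) ★★★ `competitor_energy_le_of_datumRow` — the same bound with `(ρ, Minv, hν)` replaced by the ONE datum row «`‖ν y‖ ≤ μ·w·Σ_{blk x = y}‖f x‖`».
HONEST SCOPE.  Finite-dimensional∕normed-space bookkeeping (triangle inequality, Cauchy–Schwarz per block, geometric series); no lattice, no estimate of print; every analytic input is a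
DISPLAYED scalar row.  Member reading (η-units, `D = ℓ·∇`, `A ≈ c_A·d·ℓ^{d−2}`, `B ≤ d·ℓ^d`, `h = κ·ℓ⁻¹`, `w = ℓ^{−d}`, `μ = 2∕m`): `C_P = 8d(c_A + κ²)∕m²`, ABSOLUTE.

References: T. Bałaban, CMP 96 (1984) 223–250 [Balaban1984PropagatorsII] (§1, (2.7)–(2.12): the block averages `Q′`, `N(Q′)`, `R`); CMP 99 (1985) 389–434 [Balaban1985BackgroundPropagators]
((3.19)–(3.23) pp.393–394); CMP 98 (1985) 17–51 [Balaban1985Averaging] ((11) p.19, (78)–(87) pp.30–31: the averaged axial∕comb gauges).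
-/

set_option autoImplicit false

noncomputable section

open scoped BigOperators
open Finset

namespace Summit.QuantumFields.YangMills.Theorems.Prop7BlockCompetitorEnergy

/-! ## §1 (B-N) Neumann inversion on `W →L[ℂ] W` -/

section Neumann

variable {W : Type*} [NormedAddCommGroup W] [NormedSpace ℂ W] [CompleteSpace W]

/-- ★★ **NEUMANN ON `End(W)`**: if `0 < m` and `‖M − m•1‖ ≤ m∕2` then `M` is invertible with `‖M⁻¹‖ ≤ 2∕m` (geometric series for `1 − (1 − m⁻¹M)`, `‖1 − m⁻¹M‖ ≤ ½`).  At the member: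
`M_y` = the bump-weighted block average of the relative holonomies `R(g_{y,x}s_{y,x}⁻¹)`, `m` = the bump mean, `‖M_y − m‖ ≤ 2θ₃ε₀·m` (px11 g5's row (θ″)). [folklore] -/
theorem exists_inverse_of_norm_sub_smul_one_le (M : W →L[ℂ] W) {m : ℝ} (hm : 0 < m) (hM : ‖M - (m : ℂ) • (1 : W →L[ℂ] W)‖ ≤ m / 2) :
    ∃ Minv : W →L[ℂ] W, M.comp Minv = 1 ∧ Minv.comp M = 1 ∧ ‖Minv‖ ≤ 2 / m := by
  set t : W →L[ℂ] W := 1 - ((m : ℂ)⁻¹) • M with ht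
  have hmC : (m : ℂ) ≠ 0 := by exact_mod_cast hm.ne'
  have htn : ‖t‖ ≤ 1 / 2 := by
    have e : t = ((m : ℂ)⁻¹) • ((m : ℂ) • (1 : W →L[ℂ] W) - M) := by
      rw [ht, smul_sub, smul_smul, inv_mul_cancel₀ hmC, one_smul]
    rw [e, norm_smul, norm_inv, Complex.norm_real, Real.norm_of_nonneg hm.le, ← norm_neg, neg_sub]
    rw [inv_mul_le_iff₀ hm]
    linarith
  have ht1 : ‖t‖ < 1 := by linarith
  -- `u := 1 − t = m⁻¹ M` is a unit with inverse `Σ tⁿ`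
  set u := Units.oneSub t ht1 with hu
  have huval : (u : W →L[ℂ] W) = ((m : ℂ)⁻¹) • M := by
    rw [hu, Units.val_oneSub, ht, sub_sub_cancel]
  have hinv_norm : ‖((u⁻¹ : (W →L[ℂ] W)ˣ) : W →L[ℂ] W)‖ ≤ 2 := by
    have h1 : ((u⁻¹ : (W →L[ℂ] W)ˣ) : W →L[ℂ] W) = ∑' n : ℕ, t ^ n := rfl
    rw [h1]
    have h2 := tsum_geometric_le_of_norm_lt_one t ht1
    have h3 : ‖(1 : W →L[ℂ] W)‖ ≤ 1 := ContinuousLinearMap.norm_id_le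
    have h4 : (1 - ‖t‖)⁻¹ ≤ 2 := by
      rw [inv_le_comm₀ (by linarith) (by norm_num)]
      linarith
    linarith
  refine ⟨((m : ℂ)⁻¹) • ((u⁻¹ : (W →L[ℂ] W)ˣ) : W →L[ℂ] W), ?_, ?_, ?_⟩
  · -- `M ∘ (m⁻¹ u⁻¹) = (m⁻¹ M) ∘ u⁻¹ = u u⁻¹ = 1`
    have h := u.mul_inv
    rw [huval] at h
    rw [ContinuousLinearMap.comp_smul, ← ContinuousLinearMap.mul_def]
    rw [smul_mul_assoc] at h
    exact h
  · have h := u.inv_mul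
    rw [huval] at h
    rw [ContinuousLinearMap.smul_comp, ← ContinuousLinearMap.mul_def]
    rw [mul_smul_comm] at h
    exact h
  · rw [norm_smul, norm_inv, Complex.norm_real, Real.norm_of_nonneg hm.le, div_eq_mul_inv, mul_comm]
    exact mul_le_mul_of_nonneg_right hinv_norm (inv_nonneg.mpr hm.le)

end Neumann

/-! ## §2 The exact coset match `Avg fC = Avg f` -/

section Competitor

variable {X Y E W : Type*} [NormedAddCommGroup W] [NormedSpace ℂ W]

/-- ★★ **EXACT COSET MATCH**: with `ν_y := Minv_y (Avg f y)` and `fC x := φ(x)·σ'_x ν_{blk x}`, the Neumann row (R-M) «`(w:ℂ)•Σ_{blk x = y} φ(x)•ρ_x(σ'_x(Minv_y v)) = v`» gives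
`Avg fC y = Avg f y` for every block — so `fC − f ∈ ker Avg = N(Q′)` (print's residual gauge algebra; then `⟪Q′ᵀμ, fC − f⟫ = 0` feeds ✓ `bernstein_of_competitor_adjoint_D_D_eq`).
[cite: Balaban1984PropagatorsII, (2.7)-(2.12) pp.224-225; Balaban1985BackgroundPropagators, (3.19)-(3.21) pp.393-394] -/
theorem avg_competitor_eq [Fintype X] [DecidableEq Y] (blk : X → Y) (ρ σ' : X → W →L[ℂ] W) (φ : X → ℝ) (w : ℝ) (Minv : Y → W →L[ℂ] W)
    (f : X → W) (ν : Y → W) (hν : ∀ y, ν y = Minv y (((w : ℝ) : ℂ) • ∑ x ∈ univ.filter (fun x => blk x = y), ρ x (f x)))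
    (fC : X → W) (hfC : ∀ x, fC x = ((φ x : ℝ) : ℂ) • σ' x (ν (blk x)))
    (hM : ∀ (y : Y) (v : W), ((w : ℝ) : ℂ) • ∑ x ∈ univ.filter (fun x => blk x = y), ((φ x : ℝ) : ℂ) • ρ x (σ' x (Minv y v)) = v) (y : Y) :
    ((w : ℝ) : ℂ) • ∑ x ∈ univ.filter (fun x => blk x = y), ρ x (fC x)
      = ((w : ℝ) : ℂ) • ∑ x ∈ univ.filter (fun x => blk x = y), ρ x (f x) := by
  have h : ∀ x ∈ univ.filter (fun x => blk x = y), ρ x (fC x) = ((φ x : ℝ) : ℂ) • ρ x (σ' x (Minv y (((w : ℝ) : ℂ) • ∑ x ∈ univ.filter (fun x => blk x = y), ρ x (f x)))) := by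
    intro x hx
    have hxy : blk x = y := (mem_filter.1 hx).2
    rw [hfC x, map_smul, hxy, hν y]
  rw [sum_congr rfl h]
  exact hM y _

/-! ## §3 The energy of the competitor -/

/-- ★ **ONE BOND.**  Inside a block (`blk e₋ = blk e₊`), with `σ'_{e₋}(σ_{e₋} u) = u`, `‖σ'‖, ‖τ‖ ≤ 1` and the holonomy row `‖σ_{e₋} τ_e σ'_{e₊} v − v‖ ≤ h‖v‖`:
`‖τ_e fC(e₊) − fC(e₋)‖ ≤ |φ(e₊) − φ(e₋)|·‖ν‖ + φ(e₋)·h·‖ν‖` (`ν = ν_{blk e₋}`, `0 ≤ φ`). [cite: Balaban1985Averaging, (78)-(87) pp.30-31] -/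
theorem norm_bond_term_le (blk : X → Y) (src tgt : E → X) (τ : E → W →L[ℂ] W) (σ σ' : X → W →L[ℂ] W) (φ : X → ℝ)
    (hφ0 : ∀ x, 0 ≤ φ x) (hτ : ∀ e v, ‖τ e v‖ ≤ ‖v‖) (hσ' : ∀ x v, ‖σ' x v‖ ≤ ‖v‖) (hσ'σ : ∀ x u, σ' x (σ x u) = u)
    {h : ℝ} (hhol : ∀ e, blk (src e) = blk (tgt e) → ∀ v, ‖σ (src e) (τ e (σ' (tgt e) v)) - v‖ ≤ h * ‖v‖)
    (ν : Y → W) (fC : X → W) (hfC : ∀ x, fC x = ((φ x : ℝ) : ℂ) • σ' x (ν (blk x)))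
    (e : E) (he : blk (src e) = blk (tgt e)) :
    ‖τ e (fC (tgt e)) - fC (src e)‖ ≤ (|φ (tgt e) - φ (src e)| + φ (src e) * h) * ‖ν (blk (src e))‖ := by
  rw [hfC, hfC, ← he, map_smul]
  set v : W := ν (blk (src e)) with hv
  -- split: `(φ⁺ − φ⁻)•τσ'⁺v + φ⁻•(τσ'⁺v − σ'⁻v)`
  have esplit : ((φ (tgt e) : ℝ) : ℂ) • τ e (σ' (tgt e) v) - ((φ (src e) : ℝ) : ℂ) • σ' (src e) v
      = (((φ (tgt e) - φ (src e) : ℝ)) : ℂ) • τ e (σ' (tgt e) v) + ((φ (src e) : ℝ) : ℂ) • (τ e (σ' (tgt e) v) - σ' (src e) v) := by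
    rw [Complex.ofReal_sub, sub_smul, smul_sub]
    abel
  rw [esplit]
  -- the second piece is `σ'⁻(σ⁻τσ'⁺v − v)`
  have e2 : τ e (σ' (tgt e) v) - σ' (src e) v = σ' (src e) (σ (src e) (τ e (σ' (tgt e) v)) - v) := by
    rw [map_sub, hσ'σ]
  refine (norm_add_le _ _).trans ?_
  rw [norm_smul, norm_smul, Complex.norm_real, Complex.norm_real, Real.norm_eq_abs, Real.norm_eq_abs, abs_of_nonneg (hφ0 (src e)), e2, add_mul, mul_assoc]
  refine add_le_add ?_ ?_
  · exact mul_le_mul_of_nonneg_left ((hτ e _).trans (hσ' _ _)) (abs_nonneg _)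
  · exact mul_le_mul_of_nonneg_left ((hσ' _ _).trans (hhol e he v)) (hφ0 _)

/-- ★★★ **THE COMPETITOR'S ENERGY.**  Rows: `0 ≤ φ`; across blocks `φ(e₋) = φ(e₊) = 0` (boundary layer); per block `Σ_{blk e₋ = y}(φ e₊ − φ e₋)² ≤ A` and `Σ_{blk e₋ = y}(φ e₋)² ≤ B`;
`‖τ‖, ‖σ'‖, ‖ρ‖ ≤ 1`, `σ'σ = 1`; holonomy row `‖σ_{e₋}τ_eσ'_{e₊}v − v‖ ≤ h‖v‖` inside blocks; Neumann row `‖Minv_y v‖ ≤ μ‖v‖` (`0 ≤ μ`); weight `0 ≤ w`, `w·#B(y) ≤ 1`.  THEN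
`Σ_e ‖τ_e fC(e₊) − fC(e₋)‖² ≤ 2·(A + h²·B)·μ²·w·Σ_x ‖f x‖²`.  (Member: `A = c_A·d·ℓ^{d−2}`, `B ≤ dℓ^d`, `h = κℓ⁻¹`, `w = ℓ^{−d}`, `μ = 2∕m` ⇒ `8d(c_A + κ²)∕m²·ℓ⁻²`; η-units ⇒ absolute.)
[cite: Balaban1984PropagatorsII, (2.7)-(2.12) pp.224-225; Balaban1985Averaging, (78)-(87) pp.30-31; Balaban1985BackgroundPropagators, (3.19)-(3.23) pp.393-394] -/
theorem competitor_energy_le [Fintype X] [Fintype Y] [Fintype E] [DecidableEq Y] (blk : X → Y) (src tgt : E → X) (τ : E → W →L[ℂ] W) (σ σ' ρ : X → W →L[ℂ] W) (φ : X → ℝ) (w : ℝ) (Minv : Y → W →L[ℂ] W)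
    (hφ0 : ∀ x, 0 ≤ φ x) (hτ : ∀ e v, ‖τ e v‖ ≤ ‖v‖) (hσ' : ∀ x v, ‖σ' x v‖ ≤ ‖v‖) (hσ'σ : ∀ x u, σ' x (σ x u) = u) (hρ : ∀ x v, ‖ρ x v‖ ≤ ‖v‖)
    (hinter : ∀ e, blk (src e) ≠ blk (tgt e) → φ (src e) = 0 ∧ φ (tgt e) = 0)
    {A B h μ : ℝ} (hμ : 0 ≤ μ) (hw : 0 ≤ w)
    (hA : ∀ y, ∑ e ∈ univ.filter (fun e => blk (src e) = y), (φ (tgt e) - φ (src e)) ^ 2 ≤ A)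
    (hB : ∀ y, ∑ e ∈ univ.filter (fun e => blk (src e) = y), φ (src e) ^ 2 ≤ B)
    (hhol : ∀ e, blk (src e) = blk (tgt e) → ∀ v, ‖σ (src e) (τ e (σ' (tgt e) v)) - v‖ ≤ h * ‖v‖)
    (hMinv : ∀ y v, ‖Minv y v‖ ≤ μ * ‖v‖)
    (hcard : ∀ y, w * ((univ.filter (fun x => blk x = y)).card : ℝ) ≤ 1)
    (f : X → W) (ν : Y → W) (hν : ∀ y, ν y = Minv y (((w : ℝ) : ℂ) • ∑ x ∈ univ.filter (fun x => blk x = y), ρ x (f x)))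
    (fC : X → W) (hfC : ∀ x, fC x = ((φ x : ℝ) : ℂ) • σ' x (ν (blk x))) :
    ∑ e, ‖τ e (fC (tgt e)) - fC (src e)‖ ^ 2 ≤ 2 * (A + h ^ 2 * B) * μ ^ 2 * w * ∑ x, ‖f x‖ ^ 2 := by
  -- (1) pointwise: every bond term ≤ c_e · ‖ν (blk e₋)‖²
  have hpt : ∀ e, ‖τ e (fC (tgt e)) - fC (src e)‖ ^ 2
      ≤ (2 * (φ (tgt e) - φ (src e)) ^ 2 + 2 * h ^ 2 * φ (src e) ^ 2) * ‖ν (blk (src e))‖ ^ 2 := by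
    intro e
    by_cases he : blk (src e) = blk (tgt e)
    · have hb := norm_bond_term_le blk src tgt τ σ σ' φ hφ0 hτ hσ' hσ'σ hhol ν fC hfC e he
      have h0 : 0 ≤ ‖τ e (fC (tgt e)) - fC (src e)‖ := norm_nonneg _
      have h1 : ‖τ e (fC (tgt e)) - fC (src e)‖ ^ 2 ≤ ((|φ (tgt e) - φ (src e)| + φ (src e) * h) * ‖ν (blk (src e))‖) ^ 2 :=
        pow_le_pow_left₀ h0 hb 2
      refine h1.trans ?_
      rw [mul_pow]
      refine mul_le_mul_of_nonneg_right ?_ (sq_nonneg _)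
      nlinarith [sq_nonneg (|φ (tgt e) - φ (src e)| - φ (src e) * h), sq_abs (φ (tgt e) - φ (src e))]
    · obtain ⟨hs, ht⟩ := hinter e he
      rw [hfC, hfC, hs, ht]
      simp
  -- (2) sum and regroup by the block of `e₋`
  have hsum : ∑ e, ‖τ e (fC (tgt e)) - fC (src e)‖ ^ 2
      ≤ ∑ y, (2 * A + 2 * h ^ 2 * B) * ‖ν y‖ ^ 2 := by
    calc ∑ e, ‖τ e (fC (tgt e)) - fC (src e)‖ ^ 2
        ≤ ∑ e, (2 * (φ (tgt e) - φ (src e)) ^ 2 + 2 * h ^ 2 * φ (src e) ^ 2) * ‖ν (blk (src e))‖ ^ 2 := sum_le_sum fun e _ => hpt e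
      _ = ∑ y, ∑ e ∈ univ.filter (fun e => blk (src e) = y), (2 * (φ (tgt e) - φ (src e)) ^ 2 + 2 * h ^ 2 * φ (src e) ^ 2) * ‖ν (blk (src e))‖ ^ 2 :=
          (sum_fiberwise univ (fun e => blk (src e)) _).symm
      _ = ∑ y, (∑ e ∈ univ.filter (fun e => blk (src e) = y), (2 * (φ (tgt e) - φ (src e)) ^ 2 + 2 * h ^ 2 * φ (src e) ^ 2)) * ‖ν y‖ ^ 2 := by
          refine sum_congr rfl fun y _ => ?_
          rw [sum_mul]
          refine sum_congr rfl fun e he => ?_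
          rw [(mem_filter.1 he).2]
      _ ≤ ∑ y, (2 * A + 2 * h ^ 2 * B) * ‖ν y‖ ^ 2 := by
          refine sum_le_sum fun y _ => mul_le_mul_of_nonneg_right ?_ (sq_nonneg _)
          rw [sum_add_distrib, ← mul_sum, ← mul_sum]
          have := hA y
          have := hB y
          nlinarith [sq_nonneg h]
  -- (3) per block: ‖ν y‖² ≤ μ²·w·Σ_{blk x = y}‖f x‖²
  have hν_le : ∀ y, ‖ν y‖ ^ 2 ≤ μ ^ 2 * (w * ∑ x ∈ univ.filter (fun x => blk x = y), ‖f x‖ ^ 2) := by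
    intro y
    set s := univ.filter (fun x => blk x = y) with hs
    have h1 : ‖ν y‖ ≤ μ * (w * ∑ x ∈ s, ‖f x‖) := by
      rw [hν y]
      refine (hMinv y _).trans (mul_le_mul_of_nonneg_left ?_ hμ)
      rw [norm_smul, Complex.norm_real, Real.norm_of_nonneg hw]
      refine mul_le_mul_of_nonneg_left ((norm_sum_le _ _).trans (sum_le_sum fun x _ => hρ x (f x))) hw
    have h2 : (∑ x ∈ s, ‖f x‖) ^ 2 ≤ (s.card : ℝ) * ∑ x ∈ s, ‖f x‖ ^ 2 := sq_sum_le_card_mul_sum_sq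
    have h0 : 0 ≤ μ * (w * ∑ x ∈ s, ‖f x‖) := by positivity
    have h3 : ‖ν y‖ ^ 2 ≤ (μ * (w * ∑ x ∈ s, ‖f x‖)) ^ 2 := pow_le_pow_left₀ (norm_nonneg _) h1 2
    refine h3.trans ?_
    have hS0 : 0 ≤ ∑ x ∈ s, ‖f x‖ ^ 2 := sum_nonneg fun _ _ => sq_nonneg _
    have hc := hcard y
    rw [← hs] at hc
    calc (μ * (w * ∑ x ∈ s, ‖f x‖)) ^ 2 = μ ^ 2 * (w * (w * (∑ x ∈ s, ‖f x‖) ^ 2)) := by ring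
      _ ≤ μ ^ 2 * (w * (w * ((s.card : ℝ) * ∑ x ∈ s, ‖f x‖ ^ 2))) := by gcongr
      _ = μ ^ 2 * ((w * (s.card : ℝ)) * (w * ∑ x ∈ s, ‖f x‖ ^ 2)) := by ring
      _ ≤ μ ^ 2 * (1 * (w * ∑ x ∈ s, ‖f x‖ ^ 2)) := by gcongr
      _ = μ ^ 2 * (w * ∑ x ∈ s, ‖f x‖ ^ 2) := by ring
  -- (4) assemble with the fibrewise identity `Σ_y Σ_{blk x = y} = Σ_x`
  have hAB : ∀ y : Y, 0 ≤ 2 * A + 2 * h ^ 2 * B := by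
    intro y
    have hA0 : 0 ≤ A := le_trans (sum_nonneg fun _ _ => sq_nonneg _) (hA y)
    have hB0 : 0 ≤ B := le_trans (sum_nonneg fun _ _ => sq_nonneg _) (hB y)
    positivity
  refine hsum.trans ?_
  calc ∑ y, (2 * A + 2 * h ^ 2 * B) * ‖ν y‖ ^ 2
      ≤ ∑ y, (2 * A + 2 * h ^ 2 * B) * (μ ^ 2 * (w * ∑ x ∈ univ.filter (fun x => blk x = y), ‖f x‖ ^ 2)) :=
        sum_le_sum fun y _ => mul_le_mul_of_nonneg_left (hν_le y) (hAB y)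
    _ = 2 * (A + h ^ 2 * B) * μ ^ 2 * w * ∑ y, ∑ x ∈ univ.filter (fun x => blk x = y), ‖f x‖ ^ 2 := by
        rw [mul_sum]
        refine sum_congr rfl fun y _ => ?_
        ring
    _ = 2 * (A + h ^ 2 * B) * μ ^ 2 * w * ∑ x, ‖f x‖ ^ 2 := by
        rw [sum_fiberwise univ blk (fun x => ‖f x‖ ^ 2)]

/-! ## §4 (v1.1) The same energy bound from a DATUM ROW (no `Minv`∕`ρ`∕`Avg` letters) -/

/-- ★★★ **THE COMPETITOR'S ENERGY FROM A DATUM ROW** (v1.1, for the member knit): as `competitor_energy_le`, but the per-block datum `ν` is constrained only by the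
displayed DATUM ROW «`‖ν y‖ ≤ μ·w·Σ_{blk x = y} ‖f x‖`» (which the pullback lane proves from its own averaging letters — px11 g5 (b-ℤ) `norm_datum_le` — so no
`Avg`∕`ρ`∕`Minv` letter has to be matched here): `Σ_e ‖τ_e fC(e₊) − fC(e₋)‖² ≤ 2·(A + h²·B)·μ²·w·Σ_x ‖f x‖²`.
[cite: Balaban1984PropagatorsII, (2.7)-(2.12) pp.224-225; Balaban1985Averaging, (78)-(87) pp.30-31; Balaban1985BackgroundPropagators, (3.19)-(3.23) pp.393-394] -/
theorem competitor_energy_le_of_datumRow [Fintype X] [Fintype Y] [Fintype E] [DecidableEq Y] (blk : X → Y) (src tgt : E → X) (τ : E → W →L[ℂ] W)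
    (σ σ' : X → W →L[ℂ] W) (φ : X → ℝ) (w : ℝ)
    (hφ0 : ∀ x, 0 ≤ φ x) (hτ : ∀ e v, ‖τ e v‖ ≤ ‖v‖) (hσ' : ∀ x v, ‖σ' x v‖ ≤ ‖v‖) (hσ'σ : ∀ x u, σ' x (σ x u) = u)
    (hinter : ∀ e, blk (src e) ≠ blk (tgt e) → φ (src e) = 0 ∧ φ (tgt e) = 0)
    {A B h μ : ℝ} (hw : 0 ≤ w)
    (hA : ∀ y, ∑ e ∈ univ.filter (fun e => blk (src e) = y), (φ (tgt e) - φ (src e)) ^ 2 ≤ A)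
    (hB : ∀ y, ∑ e ∈ univ.filter (fun e => blk (src e) = y), φ (src e) ^ 2 ≤ B)
    (hhol : ∀ e, blk (src e) = blk (tgt e) → ∀ v, ‖σ (src e) (τ e (σ' (tgt e) v)) - v‖ ≤ h * ‖v‖)
    (hcard : ∀ y, w * ((univ.filter (fun x => blk x = y)).card : ℝ) ≤ 1)
    (f : X → W) (ν : Y → W) (hνle : ∀ y, ‖ν y‖ ≤ μ * (w * ∑ x ∈ univ.filter (fun x => blk x = y), ‖f x‖))
    (fC : X → W) (hfC : ∀ x, fC x = ((φ x : ℝ) : ℂ) • σ' x (ν (blk x))) :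
    ∑ e, ‖τ e (fC (tgt e)) - fC (src e)‖ ^ 2 ≤ 2 * (A + h ^ 2 * B) * μ ^ 2 * w * ∑ x, ‖f x‖ ^ 2 := by
  -- (1) pointwise: every bond term ≤ c_e · ‖ν (blk e₋)‖²
  have hpt : ∀ e, ‖τ e (fC (tgt e)) - fC (src e)‖ ^ 2
      ≤ (2 * (φ (tgt e) - φ (src e)) ^ 2 + 2 * h ^ 2 * φ (src e) ^ 2) * ‖ν (blk (src e))‖ ^ 2 := by
    intro e
    by_cases he : blk (src e) = blk (tgt e)
    · have hb := norm_bond_term_le blk src tgt τ σ σ' φ hφ0 hτ hσ' hσ'σ hhol ν fC hfC e he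
      have h0 : 0 ≤ ‖τ e (fC (tgt e)) - fC (src e)‖ := norm_nonneg _
      have h1 : ‖τ e (fC (tgt e)) - fC (src e)‖ ^ 2 ≤ ((|φ (tgt e) - φ (src e)| + φ (src e) * h) * ‖ν (blk (src e))‖) ^ 2 :=
        pow_le_pow_left₀ h0 hb 2
      refine h1.trans ?_
      rw [mul_pow]
      refine mul_le_mul_of_nonneg_right ?_ (sq_nonneg _)
      nlinarith [sq_nonneg (|φ (tgt e) - φ (src e)| - φ (src e) * h), sq_abs (φ (tgt e) - φ (src e))]
    · obtain ⟨hs, ht⟩ := hinter e he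
      rw [hfC, hfC, hs, ht]
      simp
  -- (2) sum and regroup by the block of `e₋`
  have hsum : ∑ e, ‖τ e (fC (tgt e)) - fC (src e)‖ ^ 2
      ≤ ∑ y, (2 * A + 2 * h ^ 2 * B) * ‖ν y‖ ^ 2 := by
    calc ∑ e, ‖τ e (fC (tgt e)) - fC (src e)‖ ^ 2
        ≤ ∑ e, (2 * (φ (tgt e) - φ (src e)) ^ 2 + 2 * h ^ 2 * φ (src e) ^ 2) * ‖ν (blk (src e))‖ ^ 2 := sum_le_sum fun e _ => hpt e
      _ = ∑ y, ∑ e ∈ univ.filter (fun e => blk (src e) = y), (2 * (φ (tgt e) - φ (src e)) ^ 2 + 2 * h ^ 2 * φ (src e) ^ 2) * ‖ν (blk (src e))‖ ^ 2 :=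
          (sum_fiberwise univ (fun e => blk (src e)) _).symm
      _ = ∑ y, (∑ e ∈ univ.filter (fun e => blk (src e) = y), (2 * (φ (tgt e) - φ (src e)) ^ 2 + 2 * h ^ 2 * φ (src e) ^ 2)) * ‖ν y‖ ^ 2 := by
          refine sum_congr rfl fun y _ => ?_
          rw [sum_mul]
          refine sum_congr rfl fun e he => ?_
          rw [(mem_filter.1 he).2]
      _ ≤ ∑ y, (2 * A + 2 * h ^ 2 * B) * ‖ν y‖ ^ 2 := by
          refine sum_le_sum fun y _ => mul_le_mul_of_nonneg_right ?_ (sq_nonneg _)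
          rw [sum_add_distrib, ← mul_sum, ← mul_sum]
          have := hA y
          have := hB y
          nlinarith [sq_nonneg h]
  -- (3) per block: ‖ν y‖² ≤ μ²·w·Σ_{blk x = y}‖f x‖², from the datum row and Cauchy–Schwarz
  have hν_le : ∀ y, ‖ν y‖ ^ 2 ≤ μ ^ 2 * (w * ∑ x ∈ univ.filter (fun x => blk x = y), ‖f x‖ ^ 2) := by
    intro y
    set s := univ.filter (fun x => blk x = y) with hs
    have h1 : ‖ν y‖ ≤ μ * (w * ∑ x ∈ s, ‖f x‖) := hνle y
    have h2 : (∑ x ∈ s, ‖f x‖) ^ 2 ≤ (s.card : ℝ) * ∑ x ∈ s, ‖f x‖ ^ 2 := sq_sum_le_card_mul_sum_sq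
    have h3 : ‖ν y‖ ^ 2 ≤ (μ * (w * ∑ x ∈ s, ‖f x‖)) ^ 2 := pow_le_pow_left₀ (norm_nonneg _) h1 2
    refine h3.trans ?_
    have hS0 : 0 ≤ ∑ x ∈ s, ‖f x‖ ^ 2 := sum_nonneg fun _ _ => sq_nonneg _
    have hc := hcard y
    rw [← hs] at hc
    calc (μ * (w * ∑ x ∈ s, ‖f x‖)) ^ 2 = μ ^ 2 * (w * (w * (∑ x ∈ s, ‖f x‖) ^ 2)) := by ring
      _ ≤ μ ^ 2 * (w * (w * ((s.card : ℝ) * ∑ x ∈ s, ‖f x‖ ^ 2))) := by gcongr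
      _ = μ ^ 2 * ((w * (s.card : ℝ)) * (w * ∑ x ∈ s, ‖f x‖ ^ 2)) := by ring
      _ ≤ μ ^ 2 * (1 * (w * ∑ x ∈ s, ‖f x‖ ^ 2)) := by gcongr
      _ = μ ^ 2 * (w * ∑ x ∈ s, ‖f x‖ ^ 2) := by ring
  -- (4) assemble with the fibrewise identity `Σ_y Σ_{blk x = y} = Σ_x`
  have hAB : ∀ y : Y, 0 ≤ 2 * A + 2 * h ^ 2 * B := by
    intro y
    have hA0 : 0 ≤ A := le_trans (sum_nonneg fun _ _ => sq_nonneg _) (hA y)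
    have hB0 : 0 ≤ B := le_trans (sum_nonneg fun _ _ => sq_nonneg _) (hB y)
    positivity
  refine hsum.trans ?_
  calc ∑ y, (2 * A + 2 * h ^ 2 * B) * ‖ν y‖ ^ 2
      ≤ ∑ y, (2 * A + 2 * h ^ 2 * B) * (μ ^ 2 * (w * ∑ x ∈ univ.filter (fun x => blk x = y), ‖f x‖ ^ 2)) :=
        sum_le_sum fun y _ => mul_le_mul_of_nonneg_left (hν_le y) (hAB y)
    _ = 2 * (A + h ^ 2 * B) * μ ^ 2 * w * ∑ y, ∑ x ∈ univ.filter (fun x => blk x = y), ‖f x‖ ^ 2 := by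
        rw [mul_sum]
        refine sum_congr rfl fun y _ => ?_
        ring
    _ = 2 * (A + h ^ 2 * B) * μ ^ 2 * w * ∑ x, ‖f x‖ ^ 2 := by
        rw [sum_fiberwise univ blk (fun x => ‖f x‖ ^ 2)]

end Competitor

end Summit.QuantumFields.YangMills.Theorems.Prop7BlockCompetitorEnergy

end
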